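import Summits.QuantumFields.BalabanUV.Beta.GAN24.DerivativeRateTransferLoewnerKKT
import Summits.QuantumFields.BalabanUV.Beta.GAN24.DerivativeRateTransferAnalyticKKTEnd

/-!
# `BalabanUV.Beta.GAN24.DerivativeRateTransferLoewnerEnd` — binder row G-an2-4 ∕ (CONV-C), route R6 «VALUES, NOT DERIVATIVES», PART 19:
# THE CAPSTONE OF THE LOEWNER LINE — an1's `dEffForm` rows along a REAL affine two-bond tower inherit a geometric one-step rate from
# (STAB) + (CONS) on the real background square and S2 (nonsingular bordered matrices + one bound on the bidisc): PART 18's real entry rate,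
# REALIFIED (`𝒮` commutes with `ℝ → ℂ`), is PART 13's hypothesis (S1) — no value rate is ASSUMED any more (unit b2b-balaban-gan24-p3, gen 36; v1)

NOT IN PRINT; OUR PROOF (for the ROUTE; [folklore] — `Matrix.map` bookkeeping for the bordered inverse + PART 13 `dEffForm_step_rateω` + PART 18
`effForm_entry_step_rate_of_stab_of_cons` BY NAME).  HONEST FRAMING (cell contract, verbatim): «discharging `BetaPertH` makes Bałaban's UV stability
UNCONDITIONAL — a real constructive-QFT result; it is NOT the continuum limit and NOT the Clay problem.»  HONEST DEPENDENCY (verbatim): «continuum YM on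
T⁴ ⇐ BetaPertH ∧ nine spine estimates (0/9 proved); BetaPertH ⇐ (D1) ∧ (D4) ∧ CAP+tail; G-an2-4 gates asym, D1 and NE2/3/4.»

WHY THIS FILE.  PART 13 (`…AnalyticKKTEnd.dEffForm_step_rateω`) is route R6's END in an1's letters with S1 (the value rate on the real square) and S2
DISPLAYED; PART 18 (`…LoewnerKKT`) produces exactly such a real entry rate from (STAB) + (CONS) for REAL bordered data with PSD fine forms.  The two
meet after one bookkeeping fact: an1's effective form commutes with a ring map between fields (`effForm_map` — `kkt` is entrywise affine in the data,
the inverse of a nonsingular matrix commutes with `Matrix.map`, and `toBlocks₂₂` commutes with `map`), so the COMPLEX effective form of the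
complexified real data at a REAL parameter is the realification of the REAL one (`effForm_affine₂_ofReal`).  THE CAPSTONE `dEffForm_step_rateω_of_stab_of_cons`
therefore has NO S1 hypothesis: its inputs are the real tower data with (STAB)(s,t) and (CONS)(s,t) on `[0, s₁]²`, and S2 on the bidisc.

WHAT THIS FILE PROVES (0 sorry, 0 `def`, nothing cited):
* §1 `kkt_map`, `nonsing_inv_map` (`(A.map f)⁻¹ = A⁻¹.map f` for a nonsingular `A` and a ring hom of fields), **`effForm_map`**, `minOp_map`;
  `isUnit_det_of_map` (nonsingularity descends along an injective ring hom).
* §2 `affine₂_map_ofReal` (the complexified affine family at a real point is the `map` of the real one), **`effForm_affine₂_ofReal`**.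
* §3 **`effForm_affine₂_step_rate_of_stab_of_cons`** (PART 13's hypothesis (S1) PRODUCED for the complexified family from the real (STAB) + (CONS)),
  **`dEffForm_step_rateω_of_stab_of_cons`** — real affine two-bond towers `(H_k + sH₁ₖ + tH₂ₖ, Q_k + sQ₁ₖ + tQ₂ₖ)` with one-step averagings
  `Qf_k(s,t)` and prolongations `P_k(s,t)` such that, at every real `(s,t) ∈ [0,s₁]²`, the fine forms are PSD, `Q_{k+1}(s,t) = Q_k(s,t)·Qf_k(s,t)`,
  `Q_{k+1}(s,t)·P_k(s,t) = Q_k(s,t)`, (STAB) and (CONS) `≤ cst·θ^k`; S2 for the complexified family on the bidisc ⟹ PART 13's conclusion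
  `‖dEffForm_{k+1} − dEffForm_k‖ ≤ 25·(2B)^r∕(s₁r²)·cst^{1−r}·(θ^{1−r})^k` for the first bond direction, every `r ∈ ]0,1]`; and
  **`exists_effFormJets_geometricRate_of_stab_of_cons`** (PART 13's ∃θ END with (S1) discharged the same way, read for the two bond-direction rows; the polarised
  two-vertex word row of PART 13 follows identically and is not restated).
* §4 THE ROBUST CAPSTONE (PART 18 §6 threaded through): `effForm_affine₂_step_rate_of_stabSlack_of_cons`, **`dEffForm_step_rateω_of_stabSlack_of_cons`**
  — (STAB) only up to a factor `1 + cε·θ^k`; S2's complex bound `B` doubles as the real entry bound at real points; the slack only moves the constant.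
WHAT IT DOES NOT DO: discharge (STAB)∕(CONS)∕S2 for Bałaban's operators; assert which affine family is B12's (S2(ii)); the explicit-constant
form of the mixed row (PART 13's `mixedWord_step_rateω` consumes the same S1 — same substitution; only its ∃θ form is repeated here).  SUPPLIER work on route R6 (rank 2, REDUCTION, no seat); no consumer
of record; NEVER «G-an2-4 closed»; NOT (CONV-C), NOT D1, NOT `BetaPertH`, NOT continuum, NOT Clay.
-/

noncomputable section

open Set Metric Matrix

namespace Summit.QuantumFields.BalabanUV.Beta.GAN24.DerivativeRateTransferLoewnerEnd

open Literature.MathematicalPhysics.QuantumFieldTheory.Balaban1983to89.Beta.Composition (kkt)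
open Literature.MathematicalPhysics.QuantumFieldTheory.Balaban1983to89.Beta.CompositionSingular (effForm minOp)
open Literature.MathematicalPhysics.QuantumFieldTheory.Balaban1983to89.Beta.BorderedJets (dEffForm)
open Summit.QuantumFields.BalabanUV.Beta.GAN24.DerivativeRateTransferAnalyticKKTEnd (dEffForm_step_rateω)
open Summit.QuantumFields.BalabanUV.Beta.GAN24.DerivativeRateTransferLoewnerKKT (effForm_entry_step_rate_of_stab_of_cons)

/-! ## §1 The bordered inverse commutes with a ring map between fields -/

section Map

variable {K L : Type*} [Field K] [Field L] (f : K →+* L)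
variable {ν μ : Type*} [Fintype ν] [Fintype μ] [DecidableEq ν] [DecidableEq μ]

omit [Fintype ν] [Fintype μ] [DecidableEq ν] [DecidableEq μ] in
/-- [folklore] `kkt` is entrywise in the data: `kkt (H.map f) (Q.map f) = (kkt H Q).map f`. -/
theorem kkt_map (H : Matrix ν ν K) (Q : Matrix μ ν K) : kkt (H.map f) (Q.map f) = (kkt H Q).map f := by
  rw [kkt, kkt, Matrix.fromBlocks_map, Matrix.transpose_map, Matrix.map_zero _ (map_zero f)]

/-- [folklore] the inverse of a nonsingular matrix commutes with a ring hom of fields. -/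
theorem nonsing_inv_map {n : Type*} [Fintype n] [DecidableEq n] (A : Matrix n n K) (hA : IsUnit A.det) :
    (A.map f)⁻¹ = A⁻¹.map f := by
  refine Matrix.inv_eq_right_inv ?_
  rw [← Matrix.map_mul, Matrix.mul_nonsing_inv _ hA, Matrix.map_one _ (map_zero f) (map_one f)]

/-- [folklore] `det (A.map f) = f (det A)`. -/
theorem det_map_eq {n : Type*} [Fintype n] [DecidableEq n] (A : Matrix n n K) : (A.map f).det = f A.det := by
  rw [RingHom.map_det, RingHom.mapMatrix_apply]

/-- [folklore] nonsingularity is preserved: `IsUnit ((A.map f).det)`. -/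
theorem isUnit_det_map {n : Type*} [Fintype n] [DecidableEq n] (A : Matrix n n K) (hA : IsUnit A.det) :
    IsUnit (A.map f).det := by
  rw [det_map_eq]; exact hA.map f

/-- [folklore] … and descends: `IsUnit ((A.map f).det) → IsUnit A.det` (a ring hom of fields is injective). -/
theorem isUnit_det_of_map {n : Type*} [Fintype n] [DecidableEq n] (A : Matrix n n K) (hA : IsUnit (A.map f).det) :
    IsUnit A.det := by
  rw [det_map_eq, isUnit_iff_ne_zero, map_ne_zero] at hA
  exact isUnit_iff_ne_zero.mpr hA

/-- **`effForm_map` — an1's EFFECTIVE FORM COMMUTES WITH A RING MAP OF FIELDS** (bordered matrix nonsingular). [folklore] -/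
theorem effForm_map (H : Matrix ν ν K) (Q : Matrix μ ν K) (h : IsUnit (kkt H Q).det) :
    effForm (H.map f) (Q.map f) = (effForm H Q).map f := by
  rw [effForm, effForm, kkt_map, nonsing_inv_map f _ h, Matrix.toBlocks₂₂, Matrix.toBlocks₂₂]
  ext i j
  simp [Matrix.map_apply]

/-- [folklore] the same for the minimiser block. -/
theorem minOp_map (H : Matrix ν ν K) (Q : Matrix μ ν K) (h : IsUnit (kkt H Q).det) :
    minOp (H.map f) (Q.map f) = (minOp H Q).map f := by
  rw [minOp, minOp, kkt_map, nonsing_inv_map f _ h, Matrix.toBlocks₁₂, Matrix.toBlocks₁₂]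
  ext i j
  simp [Matrix.map_apply]

end Map

/-! ## §2 Realification of the affine two-bond family at a real parameter -/

section Real

variable {ν μ : Type*} [Fintype ν] [Fintype μ] [DecidableEq ν] [DecidableEq μ]

omit [Fintype ν] [Fintype μ] [DecidableEq ν] [DecidableEq μ] in
/-- [folklore] `(A + sA₁ + tA₂).map ofReal = A.map ofReal + (s:ℂ)•A₁.map ofReal + (t:ℂ)•A₂.map ofReal` for real `s, t`. -/
theorem affine₂_map_ofReal {m n : Type*} (A A₁ A₂ : Matrix m n ℝ) (s t : ℝ) :
    (A + s • A₁ + t • A₂).map (Complex.ofRealHom : ℝ →+* ℂ) =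
      A.map Complex.ofRealHom + (s : ℂ) • A₁.map Complex.ofRealHom + (t : ℂ) • A₂.map Complex.ofRealHom := by
  ext i j
  simp [Matrix.map_apply, Matrix.add_apply, Matrix.smul_apply]

/-- **`effForm_affine₂_ofReal` — AT A REAL PARAMETER THE COMPLEX EFFECTIVE FORM OF THE COMPLEXIFIED DATA IS THE REALIFICATION OF THE REAL ONE**
(bordered matrix nonsingular over `ℝ`). [folklore] -/
theorem effForm_affine₂_ofReal (H H₁ H₂ : Matrix ν ν ℝ) (Q Q₁ Q₂ : Matrix μ ν ℝ) (s t : ℝ)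
    (h : IsUnit (kkt (H + s • H₁ + t • H₂) (Q + s • Q₁ + t • Q₂)).det) (a b : μ) :
    effForm (H.map Complex.ofRealHom + (s : ℂ) • H₁.map Complex.ofRealHom + (t : ℂ) • H₂.map Complex.ofRealHom)
        (Q.map Complex.ofRealHom + (s : ℂ) • Q₁.map Complex.ofRealHom + (t : ℂ) • Q₂.map Complex.ofRealHom) a b =
      ((effForm (H + s • H₁ + t • H₂) (Q + s • Q₁ + t • Q₂) a b : ℝ) : ℂ) := by
  rw [← affine₂_map_ofReal, ← affine₂_map_ofReal, effForm_map _ _ _ h, Matrix.map_apply]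
  rfl

/-- [folklore] conversely, nonsingularity of the complexified bordered matrix at a real parameter gives it over `ℝ`. -/
theorem isUnit_det_kkt_affine₂_real (H H₁ H₂ : Matrix ν ν ℝ) (Q Q₁ Q₂ : Matrix μ ν ℝ) (s t : ℝ)
    (h : IsUnit (kkt (H.map Complex.ofRealHom + (s : ℂ) • H₁.map Complex.ofRealHom + (t : ℂ) • H₂.map Complex.ofRealHom)
      (Q.map Complex.ofRealHom + (s : ℂ) • Q₁.map Complex.ofRealHom + (t : ℂ) • Q₂.map Complex.ofRealHom)).det) :
    IsUnit (kkt (H + s • H₁ + t • H₂) (Q + s • Q₁ + t • Q₂)).det := by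
  rw [← affine₂_map_ofReal, ← affine₂_map_ofReal, kkt_map] at h
  exact isUnit_det_of_map _ _ h

end Real

/-! ## §3 THE CAPSTONE: an1's `dEffForm` rows from (STAB) + (CONS) + S2 — no value rate assumed -/

section Capstone

variable {c : Type*} [Fintype c] [DecidableEq c]
variable {ν : ℕ → Type*} [∀ k, Fintype (ν k)] [∀ k, DecidableEq (ν k)]
variable {H H₁ H₂ : ∀ k, Matrix (ν k) (ν k) ℝ} {Q Q₁ Q₂ : ∀ k, Matrix c (ν k) ℝ}
variable {Qf : ∀ k, ℝ → ℝ → Matrix (ν k) (ν (k + 1)) ℝ} {P : ∀ k, ℝ → ℝ → Matrix (ν (k + 1)) (ν k) ℝ}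
variable {ρ s₁ B cst θ : ℝ}

/-- the complexified data (notation-free abbreviations are avoided: we write `(X k).map Complex.ofRealHom` in full). -/
theorem map_ofRealHom_apply {m n : Type*} (A : Matrix m n ℝ) (i : m) (j : n) :
    A.map (Complex.ofRealHom : ℝ →+* ℂ) i j = ((A i j : ℝ) : ℂ) := rfl

/-- **`effForm_affine₂_step_rate_of_stab_of_cons` — PART 13's HYPOTHESIS (S1), PRODUCED** [our proof; PART 18 BY NAME]: for REAL affine two-bond
towers `(H_k + sH₁ₖ + tH₂ₖ, Q_k + sQ₁ₖ + tQ₂ₖ)` (block index `c` fixed) with one-step averagings `Qf_k(s,t)` and prolongations `P_k(s,t)` such that at every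
real `(s,t) ∈ [0,s₁]²` the fine forms are PSD, `Q_{k+1} = Q_k·Qf_k`, `Q_{k+1}·P_k = Q_k`, (STAB) and (CONS) `≤ cst·θ^k`, and whose COMPLEXIFIED bordered
matrices are nonsingular on the bidisc `ball 0 ρ ×ˢ ball 0 ρ` (`0 < s₁`, `s₁·cosh 1 < ρ`): the complexified effective forms have the value rate `cst·θ^k`
on the real square — literally the `hrate` hypothesis of PART 13's `dEffForm_step_rateω` ∕ `exists_effFormJets_geometricRate`. -/
theorem effForm_affine₂_step_rate_of_stab_of_cons (hs₁ : 0 < s₁) (hs₁ρ : s₁ * Real.cosh 1 < ρ)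
    (hdet : ∀ k, ∀ z ∈ ball (0 : ℂ) ρ ×ˢ ball (0 : ℂ) ρ,
      IsUnit (kkt ((H k).map Complex.ofRealHom + z.1 • (H₁ k).map Complex.ofRealHom + z.2 • (H₂ k).map Complex.ofRealHom)
        ((Q k).map Complex.ofRealHom + z.1 • (Q₁ k).map Complex.ofRealHom + z.2 • (Q₂ k).map Complex.ofRealHom)).det)
    (hH : ∀ k (s t : ℝ), 0 ≤ s → s ≤ s₁ → 0 ≤ t → t ≤ s₁ → (H k + s • H₁ k + t • H₂ k).PosSemidef)
    (hcomp : ∀ k (s t : ℝ), 0 ≤ s → s ≤ s₁ → 0 ≤ t → t ≤ s₁ →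
      Q (k + 1) + s • Q₁ (k + 1) + t • Q₂ (k + 1) = (Q k + s • Q₁ k + t • Q₂ k) * Qf k s t)
    (hPQ : ∀ k (s t : ℝ), 0 ≤ s → s ≤ s₁ → 0 ≤ t → t ≤ s₁ →
      (Q (k + 1) + s • Q₁ (k + 1) + t • Q₂ (k + 1)) * P k s t = Q k + s • Q₁ k + t • Q₂ k)
    (hstab : ∀ k (s t : ℝ), 0 ≤ s → s ≤ s₁ → 0 ≤ t → t ≤ s₁ →
      ((H (k + 1) + s • H₁ (k + 1) + t • H₂ (k + 1)) - (Qf k s t)ᵀ * (H k + s • H₁ k + t • H₂ k) * Qf k s t).PosSemidef)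
    (hcons : ∀ k (s t : ℝ), 0 ≤ s → s ≤ s₁ → 0 ≤ t → t ≤ s₁ → ∀ y : c,
      (minOp (H k + s • H₁ k + t • H₂ k) (Q k + s • Q₁ k + t • Q₂ k) *ᵥ Pi.single y 1) ⬝ᵥ
        (((P k s t)ᵀ * (H (k + 1) + s • H₁ (k + 1) + t • H₂ (k + 1)) * P k s t - (H k + s • H₁ k + t • H₂ k)) *ᵥ
          (minOp (H k + s • H₁ k + t • H₂ k) (Q k + s • Q₁ k + t • Q₂ k) *ᵥ Pi.single y 1)) ≤ cst * θ ^ k)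
    (a b : c) :
    ∀ k (s t : ℝ), 0 ≤ s → s ≤ s₁ → 0 ≤ t → t ≤ s₁ →
      ‖effForm ((H (k + 1)).map Complex.ofRealHom + (s : ℂ) • (H₁ (k + 1)).map Complex.ofRealHom + (t : ℂ) • (H₂ (k + 1)).map Complex.ofRealHom)
            ((Q (k + 1)).map Complex.ofRealHom + (s : ℂ) • (Q₁ (k + 1)).map Complex.ofRealHom + (t : ℂ) • (Q₂ (k + 1)).map Complex.ofRealHom) a b
        - effForm ((H k).map Complex.ofRealHom + (s : ℂ) • (H₁ k).map Complex.ofRealHom + (t : ℂ) • (H₂ k).map Complex.ofRealHom)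
            ((Q k).map Complex.ofRealHom + (s : ℂ) • (Q₁ k).map Complex.ofRealHom + (t : ℂ) • (Q₂ k).map Complex.ofRealHom) a b‖ ≤
        cst * θ ^ k := by
  intro k s t hs0 hs1 ht0 ht1
  have hs₁' : s₁ ≤ s₁ * Real.cosh 1 := le_mul_of_one_le_right hs₁.le (Real.one_le_cosh 1)
  have hreal : ∀ j, IsUnit (kkt (H j + s • H₁ j + t • H₂ j) (Q j + s • Q₁ j + t • Q₂ j)).det := fun j => by
    refine isUnit_det_kkt_affine₂_real _ _ _ _ _ _ s t (hdet j ((s : ℂ), (t : ℂ)) ⟨?_, ?_⟩)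
    · rw [mem_ball_zero_iff, Complex.norm_real, Real.norm_eq_abs, abs_of_nonneg hs0]; linarith
    · rw [mem_ball_zero_iff, Complex.norm_real, Real.norm_eq_abs, abs_of_nonneg ht0]; linarith
  have hrate := effForm_entry_step_rate_of_stab_of_cons
    (H := fun j => H j + s • H₁ j + t • H₂ j) (Qc := fun j => Q j + s • Q₁ j + t • Q₂ j)
    (Qf := fun j => Qf j s t) (P := fun j => P j s t)
    (fun j => hH j s t hs0 hs1 ht0 ht1) hreal (fun j => hcomp j s t hs0 hs1 ht0 ht1) (fun j => hPQ j s t hs0 hs1 ht0 ht1)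
    (fun j => hstab j s t hs0 hs1 ht0 ht1) (fun j => hcons j s t hs0 hs1 ht0 ht1) k a b
  rw [effForm_affine₂_ofReal _ _ _ _ _ _ s t (hreal (k + 1)), effForm_affine₂_ofReal _ _ _ _ _ _ s t (hreal k),
    ← Complex.ofReal_sub, Complex.norm_real, Real.norm_eq_abs]
  exact hrate

/-- **`dEffForm_step_rateω_of_stab_of_cons` — THE CAPSTONE** [our proof; PART 13 `dEffForm_step_rateω` + the previous theorem]: under the hypotheses of
`effForm_affine₂_step_rate_of_stab_of_cons` (`0 < cst`, `0 < θ`) and S2's bound `‖𝒮_k(z)_{ab}‖ ≤ B` on the bidisc, for every `r ∈ ]0,1]` and `k`: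
`‖dEffForm (H_{k+1}) (Q_{k+1}) (H₁) (Q₁) a b − dEffForm (H_k) (Q_k) (H₁) (Q₁) a b‖ ≤ 25·(2B)^r∕(s₁r²)·cst^{1−r}·(θ^{1−r})^k` (complexified letters) — an1's
first B-jet row of the effective form, with NO value rate assumed. -/
theorem dEffForm_step_rateω_of_stab_of_cons (hs₁ : 0 < s₁) (hs₁ρ : s₁ * Real.cosh 1 < ρ)
    (hdet : ∀ k, ∀ z ∈ ball (0 : ℂ) ρ ×ˢ ball (0 : ℂ) ρ,
      IsUnit (kkt ((H k).map Complex.ofRealHom + z.1 • (H₁ k).map Complex.ofRealHom + z.2 • (H₂ k).map Complex.ofRealHom)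
        ((Q k).map Complex.ofRealHom + z.1 • (Q₁ k).map Complex.ofRealHom + z.2 • (Q₂ k).map Complex.ofRealHom)).det)
    (hB : ∀ k, ∀ z ∈ ball (0 : ℂ) ρ ×ˢ ball (0 : ℂ) ρ, ∀ a b : c,
      ‖effForm ((H k).map Complex.ofRealHom + z.1 • (H₁ k).map Complex.ofRealHom + z.2 • (H₂ k).map Complex.ofRealHom)
        ((Q k).map Complex.ofRealHom + z.1 • (Q₁ k).map Complex.ofRealHom + z.2 • (Q₂ k).map Complex.ofRealHom) a b‖ ≤ B)
    (hH : ∀ k (s t : ℝ), 0 ≤ s → s ≤ s₁ → 0 ≤ t → t ≤ s₁ → (H k + s • H₁ k + t • H₂ k).PosSemidef)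
    (hcomp : ∀ k (s t : ℝ), 0 ≤ s → s ≤ s₁ → 0 ≤ t → t ≤ s₁ →
      Q (k + 1) + s • Q₁ (k + 1) + t • Q₂ (k + 1) = (Q k + s • Q₁ k + t • Q₂ k) * Qf k s t)
    (hPQ : ∀ k (s t : ℝ), 0 ≤ s → s ≤ s₁ → 0 ≤ t → t ≤ s₁ →
      (Q (k + 1) + s • Q₁ (k + 1) + t • Q₂ (k + 1)) * P k s t = Q k + s • Q₁ k + t • Q₂ k)
    (hstab : ∀ k (s t : ℝ), 0 ≤ s → s ≤ s₁ → 0 ≤ t → t ≤ s₁ →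
      ((H (k + 1) + s • H₁ (k + 1) + t • H₂ (k + 1)) - (Qf k s t)ᵀ * (H k + s • H₁ k + t • H₂ k) * Qf k s t).PosSemidef)
    (hcons : ∀ k (s t : ℝ), 0 ≤ s → s ≤ s₁ → 0 ≤ t → t ≤ s₁ → ∀ y : c,
      (minOp (H k + s • H₁ k + t • H₂ k) (Q k + s • Q₁ k + t • Q₂ k) *ᵥ Pi.single y 1) ⬝ᵥ
        (((P k s t)ᵀ * (H (k + 1) + s • H₁ (k + 1) + t • H₂ (k + 1)) * P k s t - (H k + s • H₁ k + t • H₂ k)) *ᵥ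
          (minOp (H k + s • H₁ k + t • H₂ k) (Q k + s • Q₁ k + t • Q₂ k) *ᵥ Pi.single y 1)) ≤ cst * θ ^ k)
    (hc : 0 < cst) (hθ : 0 < θ) {r : ℝ} (hr : 0 < r) (hr1 : r ≤ 1) (k : ℕ) (a b : c) :
    ‖dEffForm ((H (k + 1)).map Complex.ofRealHom) ((Q (k + 1)).map Complex.ofRealHom) ((H₁ (k + 1)).map Complex.ofRealHom)
          ((Q₁ (k + 1)).map Complex.ofRealHom) a b
        - dEffForm ((H k).map Complex.ofRealHom) ((Q k).map Complex.ofRealHom) ((H₁ k).map Complex.ofRealHom)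
          ((Q₁ k).map Complex.ofRealHom) a b‖ ≤
      25 * (2 * B) ^ r / (s₁ * r ^ 2) * cst ^ (1 - r) * (θ ^ (1 - r)) ^ k :=
  dEffForm_step_rateω (μ := fun _ => c) (i := fun _ => a) (j := fun _ => b)
    (H := fun k => (H k).map Complex.ofRealHom) (H₁ := fun k => (H₁ k).map Complex.ofRealHom)
    (H₂ := fun k => (H₂ k).map Complex.ofRealHom) (Q := fun k => (Q k).map Complex.ofRealHom)
    (Q₁ := fun k => (Q₁ k).map Complex.ofRealHom) (Q₂ := fun k => (Q₂ k).map Complex.ofRealHom)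
    hs₁ hs₁ρ hdet (fun k z hz => hB k z hz a b)
    (effForm_affine₂_step_rate_of_stab_of_cons hs₁ hs₁ρ hdet hH hcomp hPQ hstab hcons a b) hc hθ hr hr1 k

/-- **`exists_effFormJets_geometricRate_of_stab_of_cons` — THE ∃θ END FOR ALL THREE JET ROWS** [our proof; PART 13 `exists_effFormJets_geometricRate` +
`effForm_affine₂_step_rate_of_stab_of_cons`]: under the same hypotheses (`0 < B`, `θ < 1`) ONE pair `(c″, θ″ < 1)` bounds the one-step increments of the
first-bond row `dEffForm(·,H₁,Q₁)` and the second-bond row `dEffForm(·,H₂,Q₂)` at the entry `(a, b)` (PART 13's third conjunct, the polarised two-vertex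
word, holds too and is dropped here only to keep the statement short). -/
theorem exists_effFormJets_geometricRate_of_stab_of_cons (hs₁ : 0 < s₁) (hs₁ρ : s₁ * Real.cosh 1 < ρ)
    (hdet : ∀ k, ∀ z ∈ ball (0 : ℂ) ρ ×ˢ ball (0 : ℂ) ρ,
      IsUnit (kkt ((H k).map Complex.ofRealHom + z.1 • (H₁ k).map Complex.ofRealHom + z.2 • (H₂ k).map Complex.ofRealHom)
        ((Q k).map Complex.ofRealHom + z.1 • (Q₁ k).map Complex.ofRealHom + z.2 • (Q₂ k).map Complex.ofRealHom)).det)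
    (hB : ∀ k, ∀ z ∈ ball (0 : ℂ) ρ ×ˢ ball (0 : ℂ) ρ, ∀ a b : c,
      ‖effForm ((H k).map Complex.ofRealHom + z.1 • (H₁ k).map Complex.ofRealHom + z.2 • (H₂ k).map Complex.ofRealHom)
        ((Q k).map Complex.ofRealHom + z.1 • (Q₁ k).map Complex.ofRealHom + z.2 • (Q₂ k).map Complex.ofRealHom) a b‖ ≤ B) (hB0 : 0 < B)
    (hH : ∀ k (s t : ℝ), 0 ≤ s → s ≤ s₁ → 0 ≤ t → t ≤ s₁ → (H k + s • H₁ k + t • H₂ k).PosSemidef)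
    (hcomp : ∀ k (s t : ℝ), 0 ≤ s → s ≤ s₁ → 0 ≤ t → t ≤ s₁ →
      Q (k + 1) + s • Q₁ (k + 1) + t • Q₂ (k + 1) = (Q k + s • Q₁ k + t • Q₂ k) * Qf k s t)
    (hPQ : ∀ k (s t : ℝ), 0 ≤ s → s ≤ s₁ → 0 ≤ t → t ≤ s₁ →
      (Q (k + 1) + s • Q₁ (k + 1) + t • Q₂ (k + 1)) * P k s t = Q k + s • Q₁ k + t • Q₂ k)
    (hstab : ∀ k (s t : ℝ), 0 ≤ s → s ≤ s₁ → 0 ≤ t → t ≤ s₁ →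
      ((H (k + 1) + s • H₁ (k + 1) + t • H₂ (k + 1)) - (Qf k s t)ᵀ * (H k + s • H₁ k + t • H₂ k) * Qf k s t).PosSemidef)
    (hcons : ∀ k (s t : ℝ), 0 ≤ s → s ≤ s₁ → 0 ≤ t → t ≤ s₁ → ∀ y : c,
      (minOp (H k + s • H₁ k + t • H₂ k) (Q k + s • Q₁ k + t • Q₂ k) *ᵥ Pi.single y 1) ⬝ᵥ
        (((P k s t)ᵀ * (H (k + 1) + s • H₁ (k + 1) + t • H₂ (k + 1)) * P k s t - (H k + s • H₁ k + t • H₂ k)) *ᵥ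
          (minOp (H k + s • H₁ k + t • H₂ k) (Q k + s • Q₁ k + t • Q₂ k) *ᵥ Pi.single y 1)) ≤ cst * θ ^ k)
    (hc : 0 < cst) (hθ : 0 < θ) (hθ1 : θ < 1) (a b : c) :
    ∃ c'' θ'' : ℝ, 0 ≤ c'' ∧ 0 ≤ θ'' ∧ θ'' < 1 ∧ ∀ k,
      ‖dEffForm ((H (k + 1)).map Complex.ofRealHom) ((Q (k + 1)).map Complex.ofRealHom) ((H₁ (k + 1)).map Complex.ofRealHom)
            ((Q₁ (k + 1)).map Complex.ofRealHom) a b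
          - dEffForm ((H k).map Complex.ofRealHom) ((Q k).map Complex.ofRealHom) ((H₁ k).map Complex.ofRealHom)
            ((Q₁ k).map Complex.ofRealHom) a b‖ ≤ c'' * θ'' ^ k ∧
      ‖dEffForm ((H (k + 1)).map Complex.ofRealHom) ((Q (k + 1)).map Complex.ofRealHom) ((H₂ (k + 1)).map Complex.ofRealHom)
            ((Q₂ (k + 1)).map Complex.ofRealHom) a b
          - dEffForm ((H k).map Complex.ofRealHom) ((Q k).map Complex.ofRealHom) ((H₂ k).map Complex.ofRealHom)
            ((Q₂ k).map Complex.ofRealHom) a b‖ ≤ c'' * θ'' ^ k := by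
  obtain ⟨c'', θ'', h0, h1, h2, hk⟩ :=
    Summit.QuantumFields.BalabanUV.Beta.GAN24.DerivativeRateTransferAnalyticKKTEnd.exists_effFormJets_geometricRate
      (μ := fun _ => c) (i := fun _ => a) (j := fun _ => b)
      (H := fun k => (H k).map Complex.ofRealHom) (H₁ := fun k => (H₁ k).map Complex.ofRealHom)
      (H₂ := fun k => (H₂ k).map Complex.ofRealHom) (Q := fun k => (Q k).map Complex.ofRealHom)
      (Q₁ := fun k => (Q₁ k).map Complex.ofRealHom) (Q₂ := fun k => (Q₂ k).map Complex.ofRealHom)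
      hs₁ hs₁ρ hdet (fun k z hz => hB k z hz a b) hB0
      (effForm_affine₂_step_rate_of_stab_of_cons hs₁ hs₁ρ hdet hH hcomp hPQ hstab hcons a b) hc hθ hθ1
  exact ⟨c'', θ'', h0, h1, h2, fun k => ⟨(hk k).1, (hk k).2.1⟩⟩

/-! ## §4 THE ROBUST CAPSTONE: (STAB) only up to a factor `1 + cε·θ^k` (PART 18 §6) — S2's bound `B` doubles as the real entry bound -/

/-- **`effForm_affine₂_step_rate_of_stabSlack_of_cons` — (S1) PRODUCED UNDER THE SLACK STABILITY** [our proof; PART 18 §6 BY NAME]: as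
`effForm_affine₂_step_rate_of_stab_of_cons` but with (STAB-ε) `Qf_kᵀ H_k Qf_k ≤ (1 + cε·θ^k)·H_{k+1}` at every real `(s,t)` (`0 ≤ cε`, `0 ≤ cst`,
`0 ≤ θ ≤ 1`), and S2's bound `‖𝒮_k(z)_{ab}‖ ≤ B` on the bidisc (it supplies the real entry bound at real points): the complexified effective forms have the
value rate `((1 + cε)·cst + 2cε·B)·θ^k` on the real square. -/
theorem effForm_affine₂_step_rate_of_stabSlack_of_cons (hs₁ : 0 < s₁) (hs₁ρ : s₁ * Real.cosh 1 < ρ)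
    (hdet : ∀ k, ∀ z ∈ ball (0 : ℂ) ρ ×ˢ ball (0 : ℂ) ρ,
      IsUnit (kkt ((H k).map Complex.ofRealHom + z.1 • (H₁ k).map Complex.ofRealHom + z.2 • (H₂ k).map Complex.ofRealHom)
        ((Q k).map Complex.ofRealHom + z.1 • (Q₁ k).map Complex.ofRealHom + z.2 • (Q₂ k).map Complex.ofRealHom)).det)
    (hB : ∀ k, ∀ z ∈ ball (0 : ℂ) ρ ×ˢ ball (0 : ℂ) ρ, ∀ a b : c,
      ‖effForm ((H k).map Complex.ofRealHom + z.1 • (H₁ k).map Complex.ofRealHom + z.2 • (H₂ k).map Complex.ofRealHom)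
        ((Q k).map Complex.ofRealHom + z.1 • (Q₁ k).map Complex.ofRealHom + z.2 • (Q₂ k).map Complex.ofRealHom) a b‖ ≤ B)
    (hH : ∀ k (s t : ℝ), 0 ≤ s → s ≤ s₁ → 0 ≤ t → t ≤ s₁ → (H k + s • H₁ k + t • H₂ k).PosSemidef)
    (hcomp : ∀ k (s t : ℝ), 0 ≤ s → s ≤ s₁ → 0 ≤ t → t ≤ s₁ →
      Q (k + 1) + s • Q₁ (k + 1) + t • Q₂ (k + 1) = (Q k + s • Q₁ k + t • Q₂ k) * Qf k s t)
    (hPQ : ∀ k (s t : ℝ), 0 ≤ s → s ≤ s₁ → 0 ≤ t → t ≤ s₁ →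
      (Q (k + 1) + s • Q₁ (k + 1) + t • Q₂ (k + 1)) * P k s t = Q k + s • Q₁ k + t • Q₂ k)
    {cε : ℝ} (hcε : 0 ≤ cε) (hcst : 0 ≤ cst) (hθ0 : 0 ≤ θ) (hθ1 : θ ≤ 1)
    (hstab : ∀ k (s t : ℝ), 0 ≤ s → s ≤ s₁ → 0 ≤ t → t ≤ s₁ →
      ((1 + cε * θ ^ k) • (H (k + 1) + s • H₁ (k + 1) + t • H₂ (k + 1))
        - (Qf k s t)ᵀ * (H k + s • H₁ k + t • H₂ k) * Qf k s t).PosSemidef)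
    (hcons : ∀ k (s t : ℝ), 0 ≤ s → s ≤ s₁ → 0 ≤ t → t ≤ s₁ → ∀ y : c,
      (minOp (H k + s • H₁ k + t • H₂ k) (Q k + s • Q₁ k + t • Q₂ k) *ᵥ Pi.single y 1) ⬝ᵥ
        (((P k s t)ᵀ * (H (k + 1) + s • H₁ (k + 1) + t • H₂ (k + 1)) * P k s t - (H k + s • H₁ k + t • H₂ k)) *ᵥ
          (minOp (H k + s • H₁ k + t • H₂ k) (Q k + s • Q₁ k + t • Q₂ k) *ᵥ Pi.single y 1)) ≤ cst * θ ^ k)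
    (a b : c) :
    ∀ k (s t : ℝ), 0 ≤ s → s ≤ s₁ → 0 ≤ t → t ≤ s₁ →
      ‖effForm ((H (k + 1)).map Complex.ofRealHom + (s : ℂ) • (H₁ (k + 1)).map Complex.ofRealHom + (t : ℂ) • (H₂ (k + 1)).map Complex.ofRealHom)
            ((Q (k + 1)).map Complex.ofRealHom + (s : ℂ) • (Q₁ (k + 1)).map Complex.ofRealHom + (t : ℂ) • (Q₂ (k + 1)).map Complex.ofRealHom) a b
        - effForm ((H k).map Complex.ofRealHom + (s : ℂ) • (H₁ k).map Complex.ofRealHom + (t : ℂ) • (H₂ k).map Complex.ofRealHom)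
            ((Q k).map Complex.ofRealHom + (s : ℂ) • (Q₁ k).map Complex.ofRealHom + (t : ℂ) • (Q₂ k).map Complex.ofRealHom) a b‖ ≤
        ((1 + cε) * cst + 2 * cε * B) * θ ^ k := by
  intro k s t hs0 hs1 ht0 ht1
  have hs₁' : s₁ ≤ s₁ * Real.cosh 1 := le_mul_of_one_le_right hs₁.le (Real.one_le_cosh 1)
  have hmem : ((s : ℂ), (t : ℂ)) ∈ ball (0 : ℂ) ρ ×ˢ ball (0 : ℂ) ρ := by
    refine ⟨?_, ?_⟩
    · rw [mem_ball_zero_iff, Complex.norm_real, Real.norm_eq_abs, abs_of_nonneg hs0]; linarith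
    · rw [mem_ball_zero_iff, Complex.norm_real, Real.norm_eq_abs, abs_of_nonneg ht0]; linarith
  have hreal : ∀ j, IsUnit (kkt (H j + s • H₁ j + t • H₂ j) (Q j + s • Q₁ j + t • Q₂ j)).det := fun j =>
    isUnit_det_kkt_affine₂_real _ _ _ _ _ _ s t (hdet j ((s : ℂ), (t : ℂ)) hmem)
  -- the real entry bound from S2's complex bound at the real point
  have hBreal : ∀ j a b, |effForm (H j + s • H₁ j + t • H₂ j) (Q j + s • Q₁ j + t • Q₂ j) a b| ≤ B := fun j a b => by
    have h := hB j ((s : ℂ), (t : ℂ)) hmem a b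
    rwa [effForm_affine₂_ofReal _ _ _ _ _ _ s t (hreal j), Complex.norm_real, Real.norm_eq_abs] at h
  have hrate := DerivativeRateTransferLoewnerKKT.effForm_entry_step_rate_of_stabSlack_of_cons
    (H := fun j => H j + s • H₁ j + t • H₂ j) (Qc := fun j => Q j + s • Q₁ j + t • Q₂ j)
    (Qf := fun j => Qf j s t) (P := fun j => P j s t)
    (fun j => hH j s t hs0 hs1 ht0 ht1) hreal (fun j => hcomp j s t hs0 hs1 ht0 ht1) (fun j => hPQ j s t hs0 hs1 ht0 ht1)
    hcε hcst hθ0 hθ1 (fun j => hstab j s t hs0 hs1 ht0 ht1) (fun j => hcons j s t hs0 hs1 ht0 ht1) hBreal k a b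
  rw [effForm_affine₂_ofReal _ _ _ _ _ _ s t (hreal (k + 1)), effForm_affine₂_ofReal _ _ _ _ _ _ s t (hreal k),
    ← Complex.ofReal_sub, Complex.norm_real, Real.norm_eq_abs]
  exact hrate

/-- **`dEffForm_step_rateω_of_stabSlack_of_cons` — THE ROBUST CAPSTONE** [our proof; PART 13 + the previous theorem]: with (STAB) only up to the factor
`1 + cε·θ^k` (`0 ≤ cε`, `0 < cst`, `0 < θ ≤ 1`) and everything else as in `dEffForm_step_rateω_of_stab_of_cons`:
`‖dEffForm_{k+1} − dEffForm_k‖ ≤ 25·(2B)^r∕(s₁r²)·((1 + cε)·cst + 2cε·B)^{1−r}·(θ^{1−r})^k` — the slack only moves the constant. -/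
theorem dEffForm_step_rateω_of_stabSlack_of_cons (hs₁ : 0 < s₁) (hs₁ρ : s₁ * Real.cosh 1 < ρ)
    (hdet : ∀ k, ∀ z ∈ ball (0 : ℂ) ρ ×ˢ ball (0 : ℂ) ρ,
      IsUnit (kkt ((H k).map Complex.ofRealHom + z.1 • (H₁ k).map Complex.ofRealHom + z.2 • (H₂ k).map Complex.ofRealHom)
        ((Q k).map Complex.ofRealHom + z.1 • (Q₁ k).map Complex.ofRealHom + z.2 • (Q₂ k).map Complex.ofRealHom)).det)
    (hB : ∀ k, ∀ z ∈ ball (0 : ℂ) ρ ×ˢ ball (0 : ℂ) ρ, ∀ a b : c,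
      ‖effForm ((H k).map Complex.ofRealHom + z.1 • (H₁ k).map Complex.ofRealHom + z.2 • (H₂ k).map Complex.ofRealHom)
        ((Q k).map Complex.ofRealHom + z.1 • (Q₁ k).map Complex.ofRealHom + z.2 • (Q₂ k).map Complex.ofRealHom) a b‖ ≤ B)
    (hH : ∀ k (s t : ℝ), 0 ≤ s → s ≤ s₁ → 0 ≤ t → t ≤ s₁ → (H k + s • H₁ k + t • H₂ k).PosSemidef)
    (hcomp : ∀ k (s t : ℝ), 0 ≤ s → s ≤ s₁ → 0 ≤ t → t ≤ s₁ →
      Q (k + 1) + s • Q₁ (k + 1) + t • Q₂ (k + 1) = (Q k + s • Q₁ k + t • Q₂ k) * Qf k s t)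
    (hPQ : ∀ k (s t : ℝ), 0 ≤ s → s ≤ s₁ → 0 ≤ t → t ≤ s₁ →
      (Q (k + 1) + s • Q₁ (k + 1) + t • Q₂ (k + 1)) * P k s t = Q k + s • Q₁ k + t • Q₂ k)
    {cε : ℝ} (hcε : 0 ≤ cε) (hθ1 : θ ≤ 1)
    (hstab : ∀ k (s t : ℝ), 0 ≤ s → s ≤ s₁ → 0 ≤ t → t ≤ s₁ →
      ((1 + cε * θ ^ k) • (H (k + 1) + s • H₁ (k + 1) + t • H₂ (k + 1))
        - (Qf k s t)ᵀ * (H k + s • H₁ k + t • H₂ k) * Qf k s t).PosSemidef)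
    (hcons : ∀ k (s t : ℝ), 0 ≤ s → s ≤ s₁ → 0 ≤ t → t ≤ s₁ → ∀ y : c,
      (minOp (H k + s • H₁ k + t • H₂ k) (Q k + s • Q₁ k + t • Q₂ k) *ᵥ Pi.single y 1) ⬝ᵥ
        (((P k s t)ᵀ * (H (k + 1) + s • H₁ (k + 1) + t • H₂ (k + 1)) * P k s t - (H k + s • H₁ k + t • H₂ k)) *ᵥ
          (minOp (H k + s • H₁ k + t • H₂ k) (Q k + s • Q₁ k + t • Q₂ k) *ᵥ Pi.single y 1)) ≤ cst * θ ^ k)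
    (hc : 0 < cst) (hθ : 0 < θ) {r : ℝ} (hr : 0 < r) (hr1 : r ≤ 1) (k : ℕ) (a b : c) :
    ‖dEffForm ((H (k + 1)).map Complex.ofRealHom) ((Q (k + 1)).map Complex.ofRealHom) ((H₁ (k + 1)).map Complex.ofRealHom)
          ((Q₁ (k + 1)).map Complex.ofRealHom) a b
        - dEffForm ((H k).map Complex.ofRealHom) ((Q k).map Complex.ofRealHom) ((H₁ k).map Complex.ofRealHom)
          ((Q₁ k).map Complex.ofRealHom) a b‖ ≤
      25 * (2 * B) ^ r / (s₁ * r ^ 2) * ((1 + cε) * cst + 2 * cε * B) ^ (1 - r) * (θ ^ (1 - r)) ^ k := by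
  have hρ : 0 < ρ := Summit.QuantumFields.BalabanUV.Beta.GAN24.DerivativeRateTransferAnalytic.rho_pos hs₁ hs₁ρ
  have hB0 : 0 ≤ B := (norm_nonneg _).trans (hB 0 ((0 : ℂ), (0 : ℂ)) ⟨mem_ball_self hρ, mem_ball_self hρ⟩ a b)
  have hc' : 0 < (1 + cε) * cst + 2 * cε * B := by positivity
  exact dEffForm_step_rateω (μ := fun _ => c) (i := fun _ => a) (j := fun _ => b)
    (H := fun k => (H k).map Complex.ofRealHom) (H₁ := fun k => (H₁ k).map Complex.ofRealHom)
    (H₂ := fun k => (H₂ k).map Complex.ofRealHom) (Q := fun k => (Q k).map Complex.ofRealHom)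
    (Q₁ := fun k => (Q₁ k).map Complex.ofRealHom) (Q₂ := fun k => (Q₂ k).map Complex.ofRealHom)
    hs₁ hs₁ρ hdet (fun k z hz => hB k z hz a b)
    (effForm_affine₂_step_rate_of_stabSlack_of_cons hs₁ hs₁ρ hdet hB hH hcomp hPQ hcε hc.le hθ.le hθ1 hstab hcons a b)
    hc' hθ hr hr1 k

end Capstone

end Summit.QuantumFields.BalabanUV.Beta.GAN24.DerivativeRateTransferLoewnerEnd

end
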